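import Mathlib
import HarnessLib
import Summits.QuantumFields.BalabanUV.Beta.LinearizingChange267Jet
import Literature.MathematicalPhysics.QuantumFieldTheory.Balaban1983to89.B13Sect1Arith
import Literature.MathematicalPhysics.QuantumFieldTheory.Balaban1983to89.B13PkOrderEdges

/-!
# [Balaban1988RG2Cluster] Lemma 2 p. 11 «in the same way for all terms in 𝐏^{(k)}»: the (1.38) → (1.39)∕(1.43)
# DECOUPLING MECHANISM applied to the three non-local D̃-carrying terms T3, T5, T6 of [Balaban1987RG1] (2.12), in
# abstract kernel form (cell topic `Summits/QuantumFields/BalabanUV/Beta`; row-D4 terminal leaf (T4)(b))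

HONEST FRAMING (cell rule).  Discharging `BetaPertH` makes Bałaban's UV stability UNCONDITIONAL — a real constructive-QFT
result; NOT the continuum limit, NOT the Clay problem.  This module discharges NOTHING of `BetaPertH`.  It is the row-D4
owner's kernel form of one BY-ASSERTION clause of print — cell GAPS G-adv9-20 column (b) «the s-decoupling ∕ localisation of
the non-local term types T3, T5, T6 "in the same way" as the printed example T7», terminal leaf (T4)(b) of the row-D4 apex
map `BETA/REMAINDER-BETA.md` §9 — as a COMPOSITION BY NAME of accepted tree modules: pv20-g2's `B13Sect1Arith` (the iterated
Cauchy operation `cauchyOp` of (1.23)∕(1.38) and its bound with one factor `ρ∕(ρ − 1)²` per decoupled cube,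
`norm_cauchyOp_le'`, `cauchy_factor_pow_le`), b13-g12∕g13's `B13PkScaling` ∕ `B13PkOrderEdges` (the scaling `B = g_kB′`,
the operator `Qop` of the quadratic form, the per-term cubic constants `cubic_bound_T3∕T5∕T6`), and this lineage's
`LinearizingChange267` ∕ `…Jet` (the linearizing correction `D̃` and its census inputs, now THEOREMS).  Bookkeeping-grade;
NOT summit progress.  Unit `b2b-balaban-beta-an4-g31` (owner of `BINDER-OWNERS.md` row D4).

CITATION HEADER (lean-in-tree rule).  [II] = T. Bałaban, *Renormalization group approach to lattice gauge field theories.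
II. Cluster expansions*, Commun. Math. Phys. **116**, 1–22 (1988) [Balaban1988RG2Cluster] (journal page = PDF page; renders
`HOME/b2b-balaban-ref1/pages/1988-cmp116-rg-II-cluster/…-p010-x2.png`, `…-p011-x2.png`, READ AS IMAGES by this unit);
[I] = T. Bałaban, *… I. Generation of effective actions in a small field approximation and a coupling constant
renormalization in four dimensions*, Commun. Math. Phys. **109**, 249–301 (1987) [Balaban1987RG1] (renders `…-p018-x2.png`
p. 266, `…-p020-x2.png` p. 268, read as images).  WHAT IS REPRODUCED — [II] p. 10, verbatim: *"The term corresponding to a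
domain Y is represented as ∏_{Δ⊂Y∖□} ∫ds(Δ) (1∕2πi) ∫ dσ(Δ)∕(σ(Δ) − s(Δ))² V_□(σ(Y), H₁(σ(Y))B′). (1.38) The above
expression is localized in the interior of Y, with respect to 𝐔, 𝐉, B′ or B. … The underintegral expression is analytic in
σ(Y) on the polydisc |σ(Y)| ≦ e^{κ₁}. The estimates (33), (37), (55), (57), (58) [15] imply the bound |(1.38)| ≦
C₃(e^{16κ₁}|B′|)³M⁴exp(−(κ₁ − 1)M⁻⁴|Y∖□|), (1.39)"*; p. 11, verbatim: *"The above analysis was done on the example of the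
expression (1∕g_k²)V(H₁B′), but it can be done in the same way for all terms in 𝐏^{(k)}(g_k, 𝐔, 𝐉, B), and we obtain the
same decompositions and bounds, possibly with other absolute constants. In fact many of these terms are much simpler, and
the above results can be obtained applying the generalized random walk expansions directly, or even more elementary
means."* and Lemma 2 (1.42)–(1.43) *"V_k(Y, B) = ½⟨Q(Y, B), B, B⟩ + V″_k(Y, B). (1.42) The matrix elements of the operator of
the quadratic form satisfy the bound |Q(Y, B, b, b′)| ≦ C₃ε₁M⁴ exp C₂κ₁ exp(−⅛(κ₁ − 1)d_k(Y) − ½(κ₁ − 1)M⁻⁴|Y|), (1.43)"*;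
[I] (2.12) p. 268, the three terms: T3 = `(1∕g_k²)⟨H₁hD̃₃(g_kCB), J⟩`, T5 = `(1∕g_k²)⟨H₁g_kCB, Δ₁H₁hD̃(g_kCB)⟩`,
T6 = `−(1∕g_k²)⟨H₁hD̃(g_kCB), Δ₁H₁hD̃(g_kCB)⟩` (quoted in full in `LinearizingChange267Jet`).

READING (recorded as such).  WHICH OBJECTS CARRY THE DECOUPLING PARAMETERS: by [I] p. 266 (2.4) *"M(V′V^{(k)})M(V^{(k)})⁻¹ =
exp iQ̃(B′)"* the map `Q̃` is the k-fold AVERAGING in the chart `B′ = (1∕i)log V′`; hence its non-linear part `C̃`, the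
operator `h`, the correction `D̃` (the fixed point of `D = C̃(B − hD)`), `D̃₃` and the operator `C` of «B′ = CB» (p. 268,
"determined by the configuration V^{(k)}") involve NO propagator and are NOT s-decorated in [II] §1; in T3, T5, T6 the
parameters `(s, σ)` enter ONLY through the propagator-built linear operators `H₁ = H_{1,k}` ([I] (2.6)) and `Δ₁` ([I]
(2.7), "(3.127), (3.128) [13]"), modelled here as FAMILIES of bounded linear maps `H₁ s σ`, `Δ₁ s σ` indexed by the parameter
vectors, with SUP BOUNDS `KH`, `KΔ` on the constraint set of (1.38) (`s(Δ) ∈ [0,1]`, `|σ(Δ)| = ρ`, `Cstr`) — these sup bounds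
are the T3∕T5∕T6 counterpart of the input that the printed example takes from "(33), (37), (55), (57), (58) [15]" for
`H₁(σ(Y))`, i.e. they are HYPOTHESES here exactly as (1.39) is a hypothesis in `B13Ineq140`; `J` enters through a fixed
bounded linear functional `LJ = ⟨·, J⟩` (condition (ii), α₁); the pairing `⟨·, ·⟩` is an abstract bounded bilinear map `β`.
ORDER OF OPERATIONS: the print bounds the integrand of (1.38) on the σ-torus ((1.39)) and then Taylor-expands in `B′`
((1.40)); here Taylor∕scaling is applied POINTWISE in `(s, σ)` (`B13PkScaling`) and the iterated Cauchy operation afterwards, to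
the OPERATOR-valued family `(s, σ) ↦ Qop(scaled g (W s σ))(B)` — the two orders agree up to the commutation of the evaluation
`Q ↦ Q(B, B)` with the iterated integrals ([folklore] bookkeeping, NOT typed, as `B13Sect1Arith` does not re-derive that (1.23)
equals the s-derivatives).

PROVED ([folklore] bookkeeping, constants explicit).  §1 For ANY family `W s σ : E → G` of `1∕g_k²`-terms analytic with a
UNIFORM cubic constant `Kc` on `‖z‖ < R` over the constraint set: the decoupled scalar term obeys the (1.39)-analogue
`‖cauchyOp ρ l (scaled g (W · ·) B)‖ ≤ (ρ∕(ρ − 1)²)^{#l}·Kc‖g‖‖B‖³` (`norm_cauchyOp_scaled_le`), and the decoupled OPERATOR of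
the quadratic form obeys the (1.43)-analogue `‖cauchyOp ρ l (Qop(scaled g (W · ·)) B)‖ ≤ (ρ∕(ρ − 1)²)^{#l}·½·27·Kc·ε₁` on the
domain (1.34) `‖g‖‖B‖ ≤ ε₁`, `3ε₁ ≤ R` (`norm_cauchyOp_Qop_le`), = `exp(−(κ₁ − 1)·#l)·½·27·Kc·ε₁` at `ρ = e^{κ₁}`, `κ₁ ≥ 1`
(`norm_cauchyOp_Qop_le_exp`; matrix elements `…_apply_le`).  §2 T5 with decorated `H₁`, `Δ₁` and an abstract `D̃` given by
its census jet (analytic, `≤ M` on `ball 0 R_D`, `D̃0 = 0`, `DD̃(0) = 0`): uniform cubic constant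
`Kc₅ = ‖β‖·KH‖C‖·(KΔ·KH·‖h‖·(M∕R_D²)‖C‖²)` (`cubic_T5`, from `B13PkOrderEdges.cubic_bound_T5`), analyticity (`analyticOnNhd_T5`),
hence the localized (1.43)-shape bound (`T5_decoupled_bound`).  §3 THE SAME WITH `D̃ := LinearizingChange267.tildeD`, its four
jet inputs DISCHARGED by `LinearizingChange267Jet` (`T5_decoupled_bound_tildeD`).  §4 T3 (`cubic_T3`, `T3_decoupled_bound`) and
T6 (`cubic_T6`, `T6_decoupled_bound`) likewise.

NOT CLAIMED.  The sup bounds `KH`, `KΔ` of the complexified random-walk expansions of `H₁(σ)`, `Δ₁(σ)` on `|σ(Δ)| ≤ e^{κ₁}`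
(BY REFERENCE to [15] = [Balaban1985Variational] ∕ [13] in print — the shared input of T7's (1.39); cell GAPS G-B13-01…05);
the commutation of `Q ↦ Q(B,B)` with the iterated integrals and the support∕locality statement of (1.10) for the decoupled
terms (definitional); the sum over admissible `□ ⊂ Y` and the tree-decay exponents `−⅛(κ₁ − 1)d_k(Y)` of (1.43)
(`B13Ineq140.absorb140`-type bookkeeping, not repeated); the printed example T7 itself (`B13PkScaling.norm_Qop_T7_le`); the
dictionary to Bałaban's objects and the k∕volume-uniformity of all constants; NOT summit progress.
-/

set_option maxSynthPendingDepth 3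

namespace Summit.QuantumFields.BalabanUV.Beta.PkDecoupledTerms

open Metric Set Filter
open scoped NNReal Topology ContDiff
open Literature.MathematicalPhysics.QuantumFieldTheory.Balaban1983to89
open Literature.MathematicalPhysics.QuantumFieldTheory.Balaban1983to89.B13PkScaling (Qop scaled
  quadraticForm_of_scaled_cubic norm_Qop_scaled_le cubic_scaled analyticOnNhd_bilin)
open Literature.MathematicalPhysics.QuantumFieldTheory.Balaban1983to89.B13Sect1Arith (cauchyOp norm_cauchyOp_le'
  cauchy_factor_pow_le)
open Literature.MathematicalPhysics.QuantumFieldTheory.Balaban1983to89.B13ExpansionOrder (rem)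
open Literature.MathematicalPhysics.QuantumFieldTheory.Balaban1983to89.B13PkOrderEdges (cubic_bound_T5 cubic_bound_T3
  cubic_bound_T6 analyticOnNhd_T3 mapsTo_clm nonneg_of_bound)
open Summit.QuantumFields.BalabanUV.Beta.LinearizingChange267 (tildeD tildeD_zero analyticOnNhd_tildeD)
open Summit.QuantumFields.BalabanUV.Beta.LinearizingChange267Jet (norm_tildeD_le_sigma fderiv_tildeD_zero)

noncomputable section

variable {ι : Type*} [DecidableEq ι]
  {E : Type*} [NormedAddCommGroup E] [NormedSpace ℂ E] {G : Type*} [NormedAddCommGroup G] [NormedSpace ℂ G]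

/-! ## §1 The decoupling mechanism for an arbitrary family of `1∕g_k²`-terms -/

/-- The constraint set of (1.23)∕(1.38): every listed decoupling parameter has `s(Δ) ∈ [0, 1]` and `|σ(Δ)| = ρ`
(= the hypothesis of `B13Sect1Arith.norm_cauchyOp_le'`). [cite: Balaban1988RG2Cluster, (1.38) p.10] -/
def Cstr (l : List ι) (ρ : ℝ) : Set ((ι → ℝ) × (ι → ℂ)) :=
  {p | ∀ i ∈ l, p.1 i ∈ Icc (0 : ℝ) 1 ∧ p.2 i ∈ sphere (0 : ℂ) ρ}

omit [DecidableEq ι] in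
/-- Membership in the constraint set, unfolded. [folklore] -/
@[simp] theorem mem_Cstr {l : List ι} {ρ : ℝ} {s : ι → ℝ} {σ : ι → ℂ} :
    (s, σ) ∈ Cstr l ρ ↔ ∀ i ∈ l, s i ∈ Icc (0 : ℝ) 1 ∧ σ i ∈ sphere (0 : ℂ) ρ := Iff.rfl

/-- **THE (1.39)-ANALOGUE for a family** `W s σ` of terms with a UNIFORM cubic constant `Kc` on `‖z‖ < R`: the decoupled
scalar term `∏∫ds∮dσ∕(σ − s)² · g⁻²W_{s,σ}(gB)` has norm `≤ (ρ∕(ρ − 1)²)^{#cubes}·Kc‖g‖‖B‖³` for `‖B‖ < R∕‖g‖` — the cubic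
integrand bound (`B13PkScaling.cubic_scaled`) pushed through `B13Sect1Arith.norm_cauchyOp_le'`. [cite: Balaban1988RG2Cluster, (1.38)–(1.39) p.10] -/
theorem norm_cauchyOp_scaled_le {l : List ι} {ρ : ℝ} (hρ : 1 < ρ) {W : (ι → ℝ) → (ι → ℂ) → E → G} {R Kc : ℝ}
    {g : ℂ} (hg : g ≠ 0) (hK : ∀ s σ, (s, σ) ∈ Cstr l ρ → ∀ z ∈ ball (0 : E) R, ‖W s σ z‖ ≤ Kc * ‖z‖ ^ 3)
    {B : E} (hB : B ∈ ball (0 : E) (R / ‖g‖)) {s : ι → ℝ} {σ : ι → ℂ} (hsσ : (s, σ) ∈ Cstr l ρ) :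
    ‖cauchyOp ρ l (fun s σ => scaled g (W s σ) B) s σ‖ ≤ (ρ / (ρ - 1) ^ 2) ^ l.length * (Kc * ‖g‖ * ‖B‖ ^ 3) :=
  norm_cauchyOp_le' hρ l _ (fun s σ h => cubic_scaled hg (hK s σ h) B hB) s σ hsσ

omit [DecidableEq ι] in
/-- For each parameter value the scaled term IS the quadratic form of its (1.40)-operator: `g⁻²W_{s,σ}(gB) = Q_{s,σ}(B)(B, B)`
on `‖g‖‖B‖ < ε₁`, `3ε₁ ≤ R` (`B13PkScaling.quadraticForm_of_scaled_cubic`, pointwise in `(s, σ)`). [folklore] -/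
theorem scaled_eq_Qop_of_mem [CompleteSpace G] {l : List ι} {ρ : ℝ} {W : (ι → ℝ) → (ι → ℂ) → E → G} {R Kc ε₁ : ℝ}
    {g : ℂ} (hg : g ≠ 0) (hK0 : 0 ≤ Kc) (hR : 0 < R) (hW : ∀ s σ, (s, σ) ∈ Cstr l ρ → AnalyticOnNhd ℂ (W s σ) (ball 0 R))
    (hK : ∀ s σ, (s, σ) ∈ Cstr l ρ → ∀ z ∈ ball (0 : E) R, ‖W s σ z‖ ≤ Kc * ‖z‖ ^ 3) (h3 : 3 * ε₁ ≤ R)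
    {B : E} (hB : ‖g‖ * ‖B‖ < ε₁) {s : ι → ℝ} {σ : ι → ℂ} (hsσ : (s, σ) ∈ Cstr l ρ) :
    scaled g (W s σ) B = Qop (scaled g (W s σ)) B B B :=
  (quadraticForm_of_scaled_cubic hg hK0 hR (hW s σ hsσ) (hK s σ hsσ) h3 hB).1

/-- **THE (1.43)-ANALOGUE for a family**: the decoupled OPERATOR of the quadratic form,
`∏∫ds∮dσ∕(σ − s)² · Q_{s,σ}(B)`, has norm `≤ (ρ∕(ρ − 1)²)^{#cubes}·½·27·Kc·ε₁` on the domain (1.34) `‖g‖‖B‖ ≤ ε₁` (`3ε₁ ≤ R`)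
— uniform in `g_k`, linear in `ε₁` (`B13PkScaling.norm_Qop_scaled_le` pointwise, then `norm_cauchyOp_le'`). [cite: Balaban1988RG2Cluster, (1.42)–(1.43) p.11] -/
theorem norm_cauchyOp_Qop_le {l : List ι} {ρ : ℝ} (hρ : 1 < ρ) {W : (ι → ℝ) → (ι → ℂ) → E → G} {R Kc ε₁ : ℝ}
    {g : ℂ} (hg : g ≠ 0) (hK0 : 0 ≤ Kc) (hR : 0 < R) (hW : ∀ s σ, (s, σ) ∈ Cstr l ρ → AnalyticOnNhd ℂ (W s σ) (ball 0 R))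
    (hK : ∀ s σ, (s, σ) ∈ Cstr l ρ → ∀ z ∈ ball (0 : E) R, ‖W s σ z‖ ≤ Kc * ‖z‖ ^ 3) (h3 : 3 * ε₁ ≤ R)
    {B : E} (hB : ‖g‖ * ‖B‖ ≤ ε₁) {s : ι → ℝ} {σ : ι → ℂ} (hsσ : (s, σ) ∈ Cstr l ρ) :
    ‖cauchyOp ρ l (fun s σ => Qop (scaled g (W s σ)) B) s σ‖ ≤
      (ρ / (ρ - 1) ^ 2) ^ l.length * (1 / 2 * (27 * Kc * ε₁)) :=
  norm_cauchyOp_le' hρ l _ (fun s σ h => norm_Qop_scaled_le hg hK0 hR (hW s σ h) (hK s σ h) h3 hB) s σ hsσ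

/-- The same at the printed radius `ρ = e^{κ₁}`, `κ₁ ≥ 1`: the decoupling factor is `exp(−(κ₁ − 1)·#cubes)`
(`B13Sect1Arith.cauchy_factor_pow_le`) — the «exp(−(κ₁ − 1)M⁻⁴|Y∖□|)» of (1.39)∕(1.43). [cite: Balaban1988RG2Cluster, (1.39) p.10] -/
theorem norm_cauchyOp_Qop_le_exp {l : List ι} {κ₁ : ℝ} (hκ : 1 ≤ κ₁) {W : (ι → ℝ) → (ι → ℂ) → E → G} {R Kc ε₁ : ℝ}
    {g : ℂ} (hg : g ≠ 0) (hK0 : 0 ≤ Kc) (hR : 0 < R) (hε : 0 ≤ ε₁)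
    (hW : ∀ s σ, (s, σ) ∈ Cstr l (Real.exp κ₁) → AnalyticOnNhd ℂ (W s σ) (ball 0 R))
    (hK : ∀ s σ, (s, σ) ∈ Cstr l (Real.exp κ₁) → ∀ z ∈ ball (0 : E) R, ‖W s σ z‖ ≤ Kc * ‖z‖ ^ 3) (h3 : 3 * ε₁ ≤ R)
    {B : E} (hB : ‖g‖ * ‖B‖ ≤ ε₁) {s : ι → ℝ} {σ : ι → ℂ} (hsσ : (s, σ) ∈ Cstr l (Real.exp κ₁)) :
    ‖cauchyOp (Real.exp κ₁) l (fun s σ => Qop (scaled g (W s σ)) B) s σ‖ ≤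
      Real.exp (-(κ₁ - 1) * l.length) * (1 / 2 * (27 * Kc * ε₁)) := by
  have hρ : 1 < Real.exp κ₁ := by have := Real.add_one_le_exp κ₁; linarith
  exact (norm_cauchyOp_Qop_le hρ hg hK0 hR hW hK h3 hB hsσ).trans
    (mul_le_mul_of_nonneg_right (cauchy_factor_pow_le hκ l.length) (by positivity))

/-- Matrix-element form: `‖(∏∫ds∮dσ∕(σ − s)² · Q_{s,σ}(B))(u, v)‖ ≤ exp(−(κ₁ − 1)·#cubes)·½·27·Kc·ε₁·‖u‖‖v‖` — the shape of
(1.43) «|Q(Y, B, b, b′)| ≦ C₃ε₁ … exp(…)» for the family's cubic constant, without the tree-decay exponent (not typed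
here). [cite: Balaban1988RG2Cluster, (1.43) p.11] -/
theorem norm_cauchyOp_Qop_apply_le {l : List ι} {κ₁ : ℝ} (hκ : 1 ≤ κ₁) {W : (ι → ℝ) → (ι → ℂ) → E → G} {R Kc ε₁ : ℝ}
    {g : ℂ} (hg : g ≠ 0) (hK0 : 0 ≤ Kc) (hR : 0 < R) (hε : 0 ≤ ε₁)
    (hW : ∀ s σ, (s, σ) ∈ Cstr l (Real.exp κ₁) → AnalyticOnNhd ℂ (W s σ) (ball 0 R))
    (hK : ∀ s σ, (s, σ) ∈ Cstr l (Real.exp κ₁) → ∀ z ∈ ball (0 : E) R, ‖W s σ z‖ ≤ Kc * ‖z‖ ^ 3) (h3 : 3 * ε₁ ≤ R)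
    {B : E} (hB : ‖g‖ * ‖B‖ ≤ ε₁) {s : ι → ℝ} {σ : ι → ℂ} (hsσ : (s, σ) ∈ Cstr l (Real.exp κ₁)) (u v : E) :
    ‖cauchyOp (Real.exp κ₁) l (fun s σ => Qop (scaled g (W s σ)) B) s σ u v‖ ≤
      Real.exp (-(κ₁ - 1) * l.length) * (1 / 2 * (27 * Kc * ε₁)) * ‖u‖ * ‖v‖ := by
  have h := norm_cauchyOp_Qop_le_exp hκ hg hK0 hR hε hW hK h3 hB hsσ
  calc ‖cauchyOp (Real.exp κ₁) l (fun s σ => Qop (scaled g (W s σ)) B) s σ u v‖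
        ≤ ‖cauchyOp (Real.exp κ₁) l (fun s σ => Qop (scaled g (W s σ)) B) s σ‖ * ‖u‖ * ‖v‖ :=
          ContinuousLinearMap.le_opNorm₂ _ u v
    _ ≤ Real.exp (-(κ₁ - 1) * l.length) * (1 / 2 * (27 * Kc * ε₁)) * ‖u‖ * ‖v‖ := by gcongr

/-! ## §2 T5 = `(1∕g_k²)⟨H₁g_kCB, Δ₁H₁hD̃(g_kCB)⟩` with s-decorated `H₁`, `Δ₁` and an abstract `D̃` given by its jet -/

section T5

variable {F₁ F₂ V : Type*} [NormedAddCommGroup F₁] [NormedSpace ℂ F₁] [NormedAddCommGroup F₂] [NormedSpace ℂ F₂]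
  [CompleteSpace F₂] [NormedAddCommGroup V] [NormedSpace ℂ V]

/-- The T5 term BEFORE scaling, as a family over the decoupling parameters: `W₅(s,σ)(B) = β(H₁(s,σ)CB)(Δ₁(s,σ)H₁(s,σ)hD̃(CB))`
(`C` = the operator of «B′ = CB», `D` = D̃, `h`, the pairing `β`). [cite: Balaban1987RG1, (2.12) p.268] -/
def W5 (β : V →L[ℂ] V →L[ℂ] G) (H₁ : (ι → ℝ) → (ι → ℂ) → (F₁ →L[ℂ] V)) (Δ₁ : (ι → ℝ) → (ι → ℂ) → (V →L[ℂ] V))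
    (h : F₂ →L[ℂ] F₁) (D : F₁ → F₂) (C : E →L[ℂ] F₁) (s : ι → ℝ) (σ : ι → ℂ) : E → G :=
  fun B => β (H₁ s σ (C B)) (Δ₁ s σ (H₁ s σ (h (D (C B)))))

variable {β : V →L[ℂ] V →L[ℂ] G} {H₁ : (ι → ℝ) → (ι → ℂ) → (F₁ →L[ℂ] V)} {Δ₁ : (ι → ℝ) → (ι → ℂ) → (V →L[ℂ] V)}
  {h : F₂ →L[ℂ] F₁} {D : F₁ → F₂} {C : E →L[ℂ] F₁} {l : List ι} {ρ R_D M R KH KΔ : ℝ}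

omit [DecidableEq ι] in
/-- **T5's UNIFORM cubic constant**: with sup bounds `‖H₁(s,σ)‖ ≤ KH`, `‖Δ₁(s,σ)‖ ≤ KΔ` on the constraint set and the jet of
`D̃` (differentiable, `≤ M` on `ball 0 R_D`, `D̃0 = 0`, `DD̃(0) = 0`), `‖C‖R ≤ R_D`: on `‖B‖ < R`,
`‖W₅(s,σ)(B)‖ ≤ ‖β‖·(KH‖C‖)·(KΔ·KH·‖h‖·(M∕R_D²)‖C‖²)·‖B‖³` (`B13PkOrderEdges.cubic_bound_T5` + operator-norm monotonicity).
[cite: Balaban1988RG2Cluster, Lemma 2 p.11] -/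
theorem cubic_T5 (hRD : 0 < R_D) (hD : DifferentiableOn ℂ D (ball 0 R_D)) (hM : ∀ z ∈ ball (0 : F₁) R_D, ‖D z‖ ≤ M)
    (h0 : D 0 = 0) (h1 : fderiv ℂ D 0 = 0) (hCR : ‖C‖ * R ≤ R_D)
    (hH : ∀ s σ, (s, σ) ∈ Cstr l ρ → ‖H₁ s σ‖ ≤ KH) (hΔ : ∀ s σ, (s, σ) ∈ Cstr l ρ → ‖Δ₁ s σ‖ ≤ KΔ) :
    ∀ s σ, (s, σ) ∈ Cstr l ρ → ∀ B ∈ ball (0 : E) R,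
      ‖W5 β H₁ Δ₁ h D C s σ B‖ ≤ ‖β‖ * (KH * ‖C‖) * (KΔ * KH * ‖h‖ * (M / R_D ^ 2 * ‖C‖ ^ 2)) * ‖B‖ ^ 3 := by
  intro s σ hs B hB
  have hM0 : 0 ≤ M := nonneg_of_bound hRD hM
  have hKH : 0 ≤ KH := (norm_nonneg _).trans (hH s σ hs)
  have hbase := cubic_bound_T5 hRD hD hM h0 h1 C hCR ((H₁ s σ).comp C) ((Δ₁ s σ).comp ((H₁ s σ).comp h)) β B hB
  have hKΔ0 : 0 ≤ KΔ := (norm_nonneg _).trans (hΔ s σ hs)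
  have hL : ‖(H₁ s σ).comp C‖ ≤ KH * ‖C‖ :=
    (ContinuousLinearMap.opNorm_comp_le _ _).trans (by gcongr; exact hH s σ hs)
  have hA : ‖(Δ₁ s σ).comp ((H₁ s σ).comp h)‖ ≤ KΔ * KH * ‖h‖ := by
    refine (ContinuousLinearMap.opNorm_comp_le _ _).trans ?_
    have h2 : ‖(H₁ s σ).comp h‖ ≤ KH * ‖h‖ := (ContinuousLinearMap.opNorm_comp_le _ _).trans (by gcongr; exact hH s σ hs)
    calc ‖Δ₁ s σ‖ * ‖(H₁ s σ).comp h‖ ≤ KΔ * (KH * ‖h‖) := by gcongr; exact hΔ s σ hs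
      _ = KΔ * KH * ‖h‖ := by ring
  calc ‖W5 β H₁ Δ₁ h D C s σ B‖
        = ‖β (((H₁ s σ).comp C) B) (((Δ₁ s σ).comp ((H₁ s σ).comp h)) (D (C B)))‖ := rfl
    _ ≤ ‖β‖ * ‖(H₁ s σ).comp C‖ * (‖(Δ₁ s σ).comp ((H₁ s σ).comp h)‖ * (M / R_D ^ 2 * ‖C‖ ^ 2)) * ‖B‖ ^ 3 := hbase
    _ ≤ ‖β‖ * (KH * ‖C‖) * (KΔ * KH * ‖h‖ * (M / R_D ^ 2 * ‖C‖ ^ 2)) * ‖B‖ ^ 3 := by gcongr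

omit [DecidableEq ι] [CompleteSpace F₂] in
/-- Each `W₅(s,σ)` is analytic on `ball 0 R` (for `D̃` analytic on `ball 0 R_D`, `‖C‖R ≤ R_D`). [folklore] -/
theorem analyticOnNhd_T5 (hRD : 0 < R_D) (hD : AnalyticOnNhd ℂ D (ball 0 R_D)) (hCR : ‖C‖ * R ≤ R_D) (s : ι → ℝ)
    (σ : ι → ℂ) : AnalyticOnNhd ℂ (W5 β H₁ Δ₁ h D C s σ) (ball 0 R) := by
  refine analyticOnNhd_bilin β (fun z _ => ((H₁ s σ).comp C).analyticAt z) (fun z hz => ?_)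
  have h1 : AnalyticAt ℂ D (C z) := hD _ (mapsTo_clm hRD C hCR hz)
  have h2 : AnalyticAt ℂ (fun B => D (C B)) z := h1.comp (C.analyticAt z)
  exact ((Δ₁ s σ).comp ((H₁ s σ).comp h)).analyticAt _ |>.comp h2

/-- **T5, DECOUPLED — the (1.43)-shape bound**: for `κ₁ ≥ 1`, the jet of `D̃`, the sup bounds `KH`, `KΔ`, `‖C‖R ≤ R_D`,
`3ε₁ ≤ R` and `‖g‖‖B‖ ≤ ε₁`, the iterated Cauchy operation of (1.38) over the cubes `l` applied to the (1.40)-operator of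
the scaled T5 term is bounded by `exp(−(κ₁ − 1)·#l)·½·27·Kc₅·ε₁`, `Kc₅` = `cubic_T5`'s constant — linear in `ε₁`, uniform in
`g_k`, one factor `e^{−(κ₁−1)}` per decoupled cube, «in the same way» as the printed T7. [cite: Balaban1988RG2Cluster, Lemma 2 (1.43) p.11] -/
theorem T5_decoupled_bound [CompleteSpace G] {κ₁ ε₁ : ℝ} {g : ℂ} (hκ : 1 ≤ κ₁) (hg : g ≠ 0) (hε : 0 ≤ ε₁)
    (hRD : 0 < R_D) (hR : 0 < R) (hD : AnalyticOnNhd ℂ D (ball 0 R_D)) (hM : ∀ z ∈ ball (0 : F₁) R_D, ‖D z‖ ≤ M)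
    (h0 : D 0 = 0) (h1 : fderiv ℂ D 0 = 0) (hCR : ‖C‖ * R ≤ R_D)
    (hH : ∀ s σ, (s, σ) ∈ Cstr l (Real.exp κ₁) → ‖H₁ s σ‖ ≤ KH) (hΔ : ∀ s σ, (s, σ) ∈ Cstr l (Real.exp κ₁) → ‖Δ₁ s σ‖ ≤ KΔ)
    (h3 : 3 * ε₁ ≤ R) {B : E} (hB : ‖g‖ * ‖B‖ ≤ ε₁) {s : ι → ℝ} {σ : ι → ℂ} (hsσ : (s, σ) ∈ Cstr l (Real.exp κ₁)) :
    ‖cauchyOp (Real.exp κ₁) l (fun s σ => Qop (scaled g (W5 β H₁ Δ₁ h D C s σ)) B) s σ‖ ≤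
      Real.exp (-(κ₁ - 1) * l.length) *
        (1 / 2 * (27 * (‖β‖ * (KH * ‖C‖) * (KΔ * KH * ‖h‖ * (M / R_D ^ 2 * ‖C‖ ^ 2))) * ε₁)) := by
  have hM0 : 0 ≤ M := nonneg_of_bound hRD hM
  have hKH : 0 ≤ KH := (norm_nonneg _).trans (hH s σ hsσ)
  have hKΔ : 0 ≤ KΔ := (norm_nonneg _).trans (hΔ s σ hsσ)
  exact norm_cauchyOp_Qop_le_exp hκ hg (by positivity) hR hε (fun s σ _ => analyticOnNhd_T5 hRD hD hCR s σ)
    (cubic_T5 hRD hD.differentiableOn hM h0 h1 hCR hH hΔ) h3 hB hsσ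

end T5

/-! ## §3 T5 with `D̃ := LinearizingChange267.tildeD` — the jet inputs DISCHARGED -/

section T5tildeD

variable {F₁ F₂ V : Type*} [NormedAddCommGroup F₁] [NormedSpace ℂ F₁] [CompleteSpace F₁] [NormedAddCommGroup F₂]
  [NormedSpace ℂ F₂] [CompleteSpace F₂] [NormedAddCommGroup V] [NormedSpace ℂ V]
  {β : V →L[ℂ] V →L[ℂ] G} {H₁ : (ι → ℝ) → (ι → ℂ) → (F₁ →L[ℂ] V)} {Δ₁ : (ι → ℝ) → (ι → ℂ) → (V →L[ℂ] V)}
  {h : F₂ →L[ℂ] F₁} {Cn : F₁ → F₂} {C : E →L[ℂ] F₁} {l : List ι} {lam : ℝ≥0} {r ρ₀ σ₀ Mq R KH KΔ : ℝ}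

/-- **T5, DECOUPLED, FOR THE FIXED POINT `D̃`** of [I] p. 267 (`D̃ = tildeD Cn h ρ₀ σ₀`, `Cn` = the non-linear part «C̃»
with gen 30's data: `Cn 0 = 0`, λ-Lipschitz on the closed r-ball, `C^ω` on the open one, `ρ₀ + ‖h‖σ₀ < r`, `λr ≤ σ₀`,
`λ‖h‖ < 1`, quadratic onset `‖Cn x‖ ≤ Mq‖x‖²`): the four jet inputs of §2 are THEOREMS (`LinearizingChange267.
analyticOnNhd_tildeD`, `…Jet.norm_tildeD_le_sigma`, `tildeD_zero`, `…Jet.fderiv_tildeD_zero`; `R_D = ρ₀`, `M = σ₀`), so the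
(1.43)-shape bound for T5 holds with `Kc₅ = ‖β‖·(KH‖C‖)·(KΔ·KH·‖h‖·(σ₀∕ρ₀²)‖C‖²)` modulo ONLY the sup bounds `KH`, `KΔ`
and the dictionary. [cite: Balaban1988RG2Cluster, Lemma 2 (1.43) p.11] -/
theorem T5_decoupled_bound_tildeD [CompleteSpace G] {κ₁ ε₁ : ℝ} {g : ℂ} (hκ : 1 ≤ κ₁) (hg : g ≠ 0) (hε : 0 ≤ ε₁)
    (hC0 : Cn 0 = 0) (hLip : LipschitzOnWith lam Cn (closedBall (0 : F₁) r)) (hr : ρ₀ + ‖h‖ * σ₀ < r)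
    (hσ : (lam : ℝ) * r ≤ σ₀) (hσ0 : 0 ≤ σ₀) (hρ0 : 0 < ρ₀) (hq : (lam : ℝ) * ‖h‖ < 1)
    (hCω : ∀ x ∈ ball (0 : F₁) r, ContDiffAt ℂ ω Cn x) (hMq : 0 ≤ Mq)
    (hquad : ∀ x ∈ closedBall (0 : F₁) r, ‖Cn x‖ ≤ Mq * ‖x‖ ^ 2)
    (hR : 0 < R) (hCR : ‖C‖ * R ≤ ρ₀)
    (hH : ∀ s σ, (s, σ) ∈ Cstr l (Real.exp κ₁) → ‖H₁ s σ‖ ≤ KH) (hΔ : ∀ s σ, (s, σ) ∈ Cstr l (Real.exp κ₁) → ‖Δ₁ s σ‖ ≤ KΔ)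
    (h3 : 3 * ε₁ ≤ R) {B : E} (hB : ‖g‖ * ‖B‖ ≤ ε₁) {s : ι → ℝ} {σ : ι → ℂ} (hsσ : (s, σ) ∈ Cstr l (Real.exp κ₁)) :
    ‖cauchyOp (Real.exp κ₁) l (fun s σ => Qop (scaled g (W5 β H₁ Δ₁ h (tildeD Cn h ρ₀ σ₀) C s σ)) B) s σ‖ ≤
      Real.exp (-(κ₁ - 1) * l.length) *
        (1 / 2 * (27 * (‖β‖ * (KH * ‖C‖) * (KΔ * KH * ‖h‖ * (σ₀ / ρ₀ ^ 2 * ‖C‖ ^ 2))) * ε₁)) :=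
  T5_decoupled_bound hκ hg hε hρ0 hR (analyticOnNhd_tildeD hC0 hLip hr hσ hσ0 hq hCω)
    (norm_tildeD_le_sigma hC0 hLip hr hσ hσ0 hq) (tildeD_zero hC0 hLip hr.le hσ hσ0 hρ0.le hq)
    (fderiv_tildeD_zero hC0 hLip hr hσ hσ0 hρ0 hq hMq hquad) hCR hH hΔ h3 hB hsσ

end T5tildeD

/-! ## §4 T3 = `(1∕g_k²)⟨H₁hD̃₃(g_kCB), J⟩` and T6 = `−(1∕g_k²)⟨H₁hD̃(g_kCB), Δ₁H₁hD̃(g_kCB)⟩` likewise -/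

section T3T6

variable {F₁ F₂ V : Type*} [NormedAddCommGroup F₁] [NormedSpace ℂ F₁] [NormedAddCommGroup F₂] [NormedSpace ℂ F₂]
  [CompleteSpace F₂] [NormedAddCommGroup V] [NormedSpace ℂ V]
  {LJ : V →L[ℂ] G} {β : V →L[ℂ] V →L[ℂ] G} {H₁ : (ι → ℝ) → (ι → ℂ) → (F₁ →L[ℂ] V)}
  {Δ₁ : (ι → ℝ) → (ι → ℂ) → (V →L[ℂ] V)} {h : F₂ →L[ℂ] F₁} {D : F₁ → F₂} {C : E →L[ℂ] F₁} {l : List ι}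
  {ρ R_D M R KH KΔ : ℝ}

/-- The T3 term before scaling, as a family: `W₃(s,σ)(B) = LJ(H₁(s,σ)hD̃₃(CB))`, `D̃₃ = rem D̃ 2`, `LJ = ⟨·, J⟩`. [cite: Balaban1987RG1, (2.12) p.268] -/
def W3 (LJ : V →L[ℂ] G) (H₁ : (ι → ℝ) → (ι → ℂ) → (F₁ →L[ℂ] V)) (h : F₂ →L[ℂ] F₁) (D : F₁ → F₂) (C : E →L[ℂ] F₁)
    (s : ι → ℝ) (σ : ι → ℂ) : E → G :=
  fun B => (LJ.comp ((H₁ s σ).comp h)) (rem D 2 (C B))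

/-- The T6 term before scaling (up to sign), as a family: `W₆(s,σ)(B) = β(H₁(s,σ)hD̃(CB))(Δ₁(s,σ)H₁(s,σ)hD̃(CB))`. [cite: Balaban1987RG1, (2.12) p.268] -/
def W6 (β : V →L[ℂ] V →L[ℂ] G) (H₁ : (ι → ℝ) → (ι → ℂ) → (F₁ →L[ℂ] V)) (Δ₁ : (ι → ℝ) → (ι → ℂ) → (V →L[ℂ] V))
    (h : F₂ →L[ℂ] F₁) (D : F₁ → F₂) (C : E →L[ℂ] F₁) (s : ι → ℝ) (σ : ι → ℂ) : E → G :=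
  fun B => β (((H₁ s σ).comp h) (D (C B))) (((Δ₁ s σ).comp ((H₁ s σ).comp h)) (D (C B)))

omit [DecidableEq ι] in
/-- **T3's uniform cubic constant** `‖LJ‖·KH·‖h‖·(2M∕R_D³·‖C‖³)` on `ball 0 R` (`B13PkOrderEdges.cubic_bound_T3` with
`A = LJ ∘ H₁(s,σ) ∘ h`). [cite: Balaban1988RG2Cluster, Lemma 2 p.11] -/
theorem cubic_T3 (hRD : 0 < R_D) (hD : DifferentiableOn ℂ D (ball 0 R_D)) (hM : ∀ z ∈ ball (0 : F₁) R_D, ‖D z‖ ≤ M)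
    (h0 : D 0 = 0) (h1 : fderiv ℂ D 0 = 0) (hCR : ‖C‖ * R ≤ R_D) (hH : ∀ s σ, (s, σ) ∈ Cstr l ρ → ‖H₁ s σ‖ ≤ KH) :
    ∀ s σ, (s, σ) ∈ Cstr l ρ → ∀ B ∈ ball (0 : E) R,
      ‖W3 LJ H₁ h D C s σ B‖ ≤ ‖LJ‖ * KH * ‖h‖ * (2 * M / R_D ^ 3 * ‖C‖ ^ 3) * ‖B‖ ^ 3 := by
  intro s σ hs B hB
  have hM0 : 0 ≤ M := nonneg_of_bound hRD hM
  have hbase := cubic_bound_T3 hRD hD hM h0 h1 C hCR (LJ.comp ((H₁ s σ).comp h)) B hB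
  have hA : ‖LJ.comp ((H₁ s σ).comp h)‖ ≤ ‖LJ‖ * KH * ‖h‖ := by
    refine (ContinuousLinearMap.opNorm_comp_le _ _).trans ?_
    have h2 : ‖(H₁ s σ).comp h‖ ≤ KH * ‖h‖ := (ContinuousLinearMap.opNorm_comp_le _ _).trans (by gcongr; exact hH s σ hs)
    calc ‖LJ‖ * ‖(H₁ s σ).comp h‖ ≤ ‖LJ‖ * (KH * ‖h‖) := by gcongr
      _ = ‖LJ‖ * KH * ‖h‖ := by ring
  exact hbase.trans (by gcongr)

/-- **T3, DECOUPLED — the (1.43)-shape bound** with `Kc₃ = ‖LJ‖·KH·‖h‖·(2M∕R_D³)‖C‖³`. [cite: Balaban1988RG2Cluster, Lemma 2 (1.43) p.11] -/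
theorem T3_decoupled_bound [CompleteSpace G] {κ₁ ε₁ : ℝ} {g : ℂ} (hκ : 1 ≤ κ₁) (hg : g ≠ 0) (hε : 0 ≤ ε₁)
    (hRD : 0 < R_D) (hR : 0 < R) (hD : AnalyticOnNhd ℂ D (ball 0 R_D)) (hM : ∀ z ∈ ball (0 : F₁) R_D, ‖D z‖ ≤ M)
    (h0 : D 0 = 0) (h1 : fderiv ℂ D 0 = 0) (hCR : ‖C‖ * R ≤ R_D)
    (hH : ∀ s σ, (s, σ) ∈ Cstr l (Real.exp κ₁) → ‖H₁ s σ‖ ≤ KH)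
    (h3 : 3 * ε₁ ≤ R) {B : E} (hB : ‖g‖ * ‖B‖ ≤ ε₁) {s : ι → ℝ} {σ : ι → ℂ} (hsσ : (s, σ) ∈ Cstr l (Real.exp κ₁)) :
    ‖cauchyOp (Real.exp κ₁) l (fun s σ => Qop (scaled g (W3 LJ H₁ h D C s σ)) B) s σ‖ ≤
      Real.exp (-(κ₁ - 1) * l.length) * (1 / 2 * (27 * (‖LJ‖ * KH * ‖h‖ * (2 * M / R_D ^ 3 * ‖C‖ ^ 3)) * ε₁)) := by
  have hM0 : 0 ≤ M := nonneg_of_bound hRD hM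
  have hKH : 0 ≤ KH := (norm_nonneg _).trans (hH s σ hsσ)
  exact norm_cauchyOp_Qop_le_exp hκ hg (by positivity) hR hε
    (fun s σ _ => analyticOnNhd_T3 hRD hD C hCR (LJ.comp ((H₁ s σ).comp h)))
    (cubic_T3 hRD hD.differentiableOn hM h0 h1 hCR hH) h3 hB hsσ

omit [DecidableEq ι] in
/-- **T6's uniform cubic constant** `‖β‖·(KH‖h‖b)·(KΔ·KH·‖h‖·b)·R`, `b = (M∕R_D²)‖C‖²` (`B13PkOrderEdges.cubic_bound_T6`).
[cite: Balaban1988RG2Cluster, Lemma 2 p.11] -/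
theorem cubic_T6 (hRD : 0 < R_D) (hD : DifferentiableOn ℂ D (ball 0 R_D)) (hM : ∀ z ∈ ball (0 : F₁) R_D, ‖D z‖ ≤ M)
    (h0 : D 0 = 0) (h1 : fderiv ℂ D 0 = 0) (hCR : ‖C‖ * R ≤ R_D) (hR0 : 0 ≤ R)
    (hH : ∀ s σ, (s, σ) ∈ Cstr l ρ → ‖H₁ s σ‖ ≤ KH) (hΔ : ∀ s σ, (s, σ) ∈ Cstr l ρ → ‖Δ₁ s σ‖ ≤ KΔ) :
    ∀ s σ, (s, σ) ∈ Cstr l ρ → ∀ B ∈ ball (0 : E) R,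
      ‖W6 β H₁ Δ₁ h D C s σ B‖ ≤ ‖β‖ * (KH * ‖h‖ * (M / R_D ^ 2 * ‖C‖ ^ 2)) *
        (KΔ * KH * ‖h‖ * (M / R_D ^ 2 * ‖C‖ ^ 2)) * R * ‖B‖ ^ 3 := by
  intro s σ hs B hB
  have hM0 : 0 ≤ M := nonneg_of_bound hRD hM
  have hbase := cubic_bound_T6 hRD hD hM h0 h1 C hCR ((H₁ s σ).comp h) ((Δ₁ s σ).comp ((H₁ s σ).comp h)) β B hB
  have hKH : 0 ≤ KH := (norm_nonneg _).trans (hH s σ hs)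
  have hKΔ0 : 0 ≤ KΔ := (norm_nonneg _).trans (hΔ s σ hs)
  have h2 : ‖(H₁ s σ).comp h‖ ≤ KH * ‖h‖ := (ContinuousLinearMap.opNorm_comp_le _ _).trans (by gcongr; exact hH s σ hs)
  have hA : ‖(Δ₁ s σ).comp ((H₁ s σ).comp h)‖ ≤ KΔ * KH * ‖h‖ := by
    refine (ContinuousLinearMap.opNorm_comp_le _ _).trans ?_
    calc ‖Δ₁ s σ‖ * ‖(H₁ s σ).comp h‖ ≤ KΔ * (KH * ‖h‖) := by gcongr; exact hΔ s σ hs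
      _ = KΔ * KH * ‖h‖ := by ring
  exact hbase.trans (by gcongr)

omit [DecidableEq ι] [CompleteSpace F₂] in
/-- Each `W₆(s,σ)` is analytic on `ball 0 R`. [folklore] -/
theorem analyticOnNhd_T6 (hRD : 0 < R_D) (hD : AnalyticOnNhd ℂ D (ball 0 R_D)) (hCR : ‖C‖ * R ≤ R_D) (s : ι → ℝ)
    (σ : ι → ℂ) : AnalyticOnNhd ℂ (W6 β H₁ Δ₁ h D C s σ) (ball 0 R) := by
  have hDC : ∀ z ∈ ball (0 : E) R, AnalyticAt ℂ (fun B => D (C B)) z :=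
    fun z hz => (hD _ (mapsTo_clm hRD C hCR hz)).comp (C.analyticAt z)
  exact analyticOnNhd_bilin β (fun z hz => (((H₁ s σ).comp h).analyticAt _).comp (hDC z hz))
    (fun z hz => (((Δ₁ s σ).comp ((H₁ s σ).comp h)).analyticAt _).comp (hDC z hz))

/-- **T6, DECOUPLED — the (1.43)-shape bound** with `Kc₆` = `cubic_T6`'s constant. [cite: Balaban1988RG2Cluster, Lemma 2 (1.43) p.11] -/
theorem T6_decoupled_bound [CompleteSpace G] {κ₁ ε₁ : ℝ} {g : ℂ} (hκ : 1 ≤ κ₁) (hg : g ≠ 0) (hε : 0 ≤ ε₁)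
    (hRD : 0 < R_D) (hR : 0 < R) (hD : AnalyticOnNhd ℂ D (ball 0 R_D)) (hM : ∀ z ∈ ball (0 : F₁) R_D, ‖D z‖ ≤ M)
    (h0 : D 0 = 0) (h1 : fderiv ℂ D 0 = 0) (hCR : ‖C‖ * R ≤ R_D)
    (hH : ∀ s σ, (s, σ) ∈ Cstr l (Real.exp κ₁) → ‖H₁ s σ‖ ≤ KH) (hΔ : ∀ s σ, (s, σ) ∈ Cstr l (Real.exp κ₁) → ‖Δ₁ s σ‖ ≤ KΔ)
    (h3 : 3 * ε₁ ≤ R) {B : E} (hB : ‖g‖ * ‖B‖ ≤ ε₁) {s : ι → ℝ} {σ : ι → ℂ} (hsσ : (s, σ) ∈ Cstr l (Real.exp κ₁)) :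
    ‖cauchyOp (Real.exp κ₁) l (fun s σ => Qop (scaled g (W6 β H₁ Δ₁ h D C s σ)) B) s σ‖ ≤
      Real.exp (-(κ₁ - 1) * l.length) * (1 / 2 * (27 * (‖β‖ * (KH * ‖h‖ * (M / R_D ^ 2 * ‖C‖ ^ 2)) *
        (KΔ * KH * ‖h‖ * (M / R_D ^ 2 * ‖C‖ ^ 2)) * R) * ε₁)) := by
  have hM0 : 0 ≤ M := nonneg_of_bound hRD hM
  have hKH : 0 ≤ KH := (norm_nonneg _).trans (hH s σ hsσ)
  have hKΔ : 0 ≤ KΔ := (norm_nonneg _).trans (hΔ s σ hsσ)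
  exact norm_cauchyOp_Qop_le_exp hκ hg (by positivity) hR hε (fun s σ _ => analyticOnNhd_T6 hRD hD hCR s σ)
    (cubic_T6 hRD hD.differentiableOn hM h0 h1 hCR hR.le hH hΔ) h3 hB hsσ

end T3T6

end

end Summit.QuantumFields.BalabanUV.Beta.PkDecoupledTerms
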